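import Summits.CriticalPhenomena.CardyFormulaZ2.Theorems.CardyBoundaryCoulombGasBoundaryDefectGaussianRStubTransportPathsPart29

/-!
# Stub `stub_transportPaths` of line `rainbow-monomials-in-excursion-kernels` — Part 31:
# the parked points: flatness and pairwise separation of initial points and slots
# (crux `CardyBoundaryCoulombGas.BoundaryDefectGaussianR`, stmt-CriticalPhenomena-14132)

`tp_parked_facts`: every initial rail point and every slot is flat at both radii (`tp_env` (A')),
and any two of them (two initial points, two slots, an initial point and a slot) are separated
(`dmm - r/2`, same rail, `dA - r/4 - s₀ - δ`). [folklore]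
-/

noncomputable section

open Set Filter Metric Topology Literature.Probability.RandomPlanarGeometry
open Literature.Probability.LatticeModels Literature.Probability.LatticeModels.CollarLegModel
open Summit.CriticalPhenomena.CardyFormulaZ2.Cruxes.RectilinearCardy.ExcursionKernelCovariance

namespace Summit.CriticalPhenomena.CardyFormulaZ2.Cruxes.BoundaryDefectGaussianR.RainbowMonomialsInExcursionKernels

/-- The distance of two slots on the anchor rail. [folklore] -/
theorem tp_slots_apart {r δ : ℝ} (hδ : 0 < δ) (hr : 0 ≤ r) {x₁ x₂ : ℤ} (hne : x₁ ≠ x₂)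
    (h : (r / δ) ^ 2 ≤ (((x₁ - x₂) ^ 2 : ℤ) : ℝ)) (an1 : ℤ) :
    r / δ ≤ |(((an1 + x₁) - (an1 + x₂) : ℤ) : ℝ)| := by
  rw [show (an1 + x₁) - (an1 + x₂) = x₁ - x₂ by ring]
  rcases lt_or_gt_of_ne hne with hlt | hlt
  · have := tp_slot_gap hδ hr hlt (by rw [show (x₂ - x₁) ^ 2 = (x₁ - x₂) ^ 2 by ring]; exact h)
    rw [abs_of_nonpos (by push_cast; linarith [show (x₁ : ℝ) < x₂ by exact_mod_cast hlt])]
    push_cast at this ⊢; linarith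
  · have := tp_slot_gap hδ hr hlt h
    rw [abs_of_nonneg (by push_cast; linarith [show (x₂ : ℝ) < x₁ by exact_mod_cast hlt])]
    exact this

/-- **Registered sub-goal `s7_slotsApart` of stub `stub_transportPaths`** (distance of two slots,
one-line form of `tp_slots_apart`). [folklore] -/
theorem s7_slotsApart : ∀ (r δ : ℝ), (0 < δ) → (0 ≤ r) → ∀ (x₁ x₂ : ℤ), (x₁ ≠ x₂) → ((r / δ) ^ 2 ≤ (((x₁ - x₂) ^ 2 : ℤ) : ℝ)) → ∀ (an1 : ℤ), r / δ ≤ |(((an1 + x₁) - (an1 + x₂) : ℤ) : ℝ)| :=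
  fun _ _ hδ hr _ _ hne h an1 => tp_slots_apart hδ hr hne h an1

set_option maxHeartbeats 4000000 in
/-- **The parked points.** See the module docstring. [folklore] -/
theorem tp_parked_facts {k : ℕ} (D : MarkedDomain k) {c : ℤ → ℝ} {a : ℤ → ℕ}
    (hcmono : StrictMono c) (ha4 : ∀ z, a z < 4)
    (hdir : ∀ z, ∀ t ∈ Icc (c z) (c (z + 1)), D.boundary t =
      D.boundary (c z) + ((‖D.boundary t - D.boundary (c z)‖ : ℝ) : ℂ) * Complex.I ^ (a z))
    (hmono : ∀ z, StrictMonoOn (fun t => ‖D.boundary t - D.boundary (c z)‖) (Icc (c z) (c (z + 1))))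
    {δ r s₀ : ℝ} (hδ : 0 < δ) (hδr : 64 * δ ≤ r)
    {V : Finset (ℤ × ℤ)} (K : ℤ → Fin 4) (hK : ∀ z, K z = Fin.ofNat 4 (a z)) (Y : ℤ → ℤ)
    (hY : ∀ z, Y z = ⌈(D.boundary (c z) * (-Complex.I) ^ (a z)).im / δ⌉)
    (Fl FlR : ℤ × ℤ → Prop) (Sep : ℤ × ℤ → ℤ × ℤ → Prop)
    (hSep : ∀ u v, Sep u v ↔ (r / δ) ^ 2 ≤ ((((u.1 - v.1) ^ 2 + (u.2 - v.2) ^ 2 : ℤ)) : ℝ))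
    (hA' : ∀ (z x : ℤ), δ * ((⌈r / δ⌉₊ : ℕ) + 1) ≤ δ * x - (D.boundary (c z) * (-Complex.I) ^ (a
      z)).re → δ * x - (D.boundary (c z) * (-Complex.I) ^ (a z)).re ≤ ‖D.boundary (c (z + 1)) -
      D.boundary (c z)‖ - δ * ((⌈r / δ⌉₊ : ℕ) + 1) → FlR ((x) • dir (K (z)) + Y (z) • dir (K (z) +
      1)) ∧ Fl ((x) • dir (K (z)) + Y (z) • dir (K (z) + 1)) ∧ ((x) • dir (K (z)) + Y (z) • dir (K
      (z) + 1)) ∈ V ∧ ((x) • dir (K (z)) + Y (z) • dir (K (z) + 1)) + dir (K (z) + 3) ∉ V ∧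
      ((neighbours ((x) • dir (K (z)) + Y (z) • dir (K (z) + 1))).filter (fun w ↦ w ∉ V)).card = 1
      ∧ outDart V ((x) • dir (K (z)) + Y (z) • dir (K (z) + 1)) = some (((x) • dir (K (z)) + Y (z)
      • dir (K (z) + 1)), K (z) + 3))
    (zm : Fin k → ℤ) (hzm : ∀ i, D.mark i ∈ Ioo (c (zm i)) (c (zm i + 1))) {α : ℝ} {zA : ℤ}
    (hzA0 : a zA = 0) (hαA : α ∈ Ioo (c zA) (c (zA + 1)))
    {dmm dA dmc dAc : ℝ}
    (hdmm : ∀ i i', i ≠ i' → dmm ≤ dist (D.pt i) (D.pt i'))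
    (hdA : ∀ i, dA ≤ dist (D.boundary α) (D.pt i))
    (hdmc : ∀ i, dmc ≤ ‖D.pt i - D.boundary (c (zm i))‖ ∧ dmc ≤ ‖D.boundary (c (zm i + 1)) - D.pt i‖)
    (hdAc : dAc ≤ ‖D.boundary α - D.boundary (c zA)‖ ∧ dAc ≤ ‖D.boundary (c (zA + 1)) - D.boundary α‖)
    (hrdmm : 16 * r ≤ dmm) (hrdA : 16 * r ≤ dA) (hrdmc : 16 * r ≤ dmc) (hrdAc : 16 * r ≤ dAc)
    (hs₀A : 4 * s₀ ≤ dA) (hs₀Ac : 4 * s₀ ≤ dAc)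
    (p : Fin k → ℤ × ℤ) (xi : Fin k → ℤ)
    (hp_eq : ∀ i, p i = (xi i) • dir (K (zm i)) + Y (zm i) • dir (K (zm i) + 1))
    (hp_coord : ∀ i, |δ * (xi i : ℤ) - ((D.boundary (c (zm i)) * (-Complex.I) ^ (a (zm i))).re +
      ‖D.pt i - D.boundary (c (zm i))‖)| ≤ r / 4)
    (x : Fin k → ℤ) (hxsep : ∀ i₁ i₂ : Fin k, i₁ ≠ i₂ → (r / δ) ^ 2 ≤ (((x i₁ - x i₂) ^ 2 : ℤ) : ℝ))
    (hxs₀ : ∀ i, |δ * (x i : ℤ)| ≤ s₀) (an1 : ℤ)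
    (han1 : (D.boundary α).re - δ < δ * an1 ∧ δ * an1 ≤ (D.boundary α).re) :
    (∀ i, Fl (p i) ∧ FlR (p i)) ∧ (∀ i, Fl ((an1 + x i) • dir (K zA) + Y zA • dir (K zA + 1)) ∧
      FlR ((an1 + x i) • dir (K zA) + Y zA • dir (K zA + 1))) ∧ (∀ i₁ i₂, i₁ ≠ i₂ → Sep (p i₁) (p
      i₂)) ∧ (∀ i₁ i₂, i₁ ≠ i₂ → Sep ((an1 + x i₁) • dir (K zA) + Y zA • dir (K zA + 1)) ((an1 + x
      i₂) • dir (K zA) + Y zA • dir (K zA + 1))) ∧ (∀ i₁ i₂, Sep (p i₁) ((an1 + x i₂) • dir (K zA)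
      + Y zA • dir (K zA + 1)) ∧ Sep ((an1 + x i₂) • dir (K zA) + Y zA • dir (K zA + 1)) (p i₁)) := by
  have hr : 0 < r := by linarith
  have hpt : ∀ i, D.pt i = D.boundary (D.mark i) := fun i => rfl
  have hczlt : ∀ z : ℤ, c z < c (z + 1) := fun z => hcmono (by omega)
  have hmr : δ * (((⌈r / δ⌉₊ : ℕ) : ℝ) + 1) < r + 2 * δ := tp_radius_margin hδ hr.le
  have hm0 : 0 ≤ δ * (((⌈r / δ⌉₊ : ℕ) : ℝ) + 1) := by positivity
  have hinit := fun i => abs_le.1 (hp_coord i)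
  -- margins of the initial points
  have hmi : ∀ i, dmc ≤ ‖D.pt i - D.boundary (c (zm i))‖ ∧
      ‖D.pt i - D.boundary (c (zm i))‖ ≤ ‖D.boundary (c (zm i + 1)) - D.boundary (c (zm i))‖ - dmc := by
    intro i
    obtain ⟨-, -, h3⟩ := tp_inside_dist D.toJordanDomain hcmono hdir hmono (zm i) (hzm i)
    have hd := hdmc i
    rw [← hpt] at h3
    change ‖D.boundary (c (zm i + 1)) - D.pt i‖ =
      ‖D.boundary (c (zm i + 1)) - D.boundary (c (zm i))‖ - ‖D.pt i - D.boundary (c (zm i))‖ at h3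
    rw [h3] at hd
    exact ⟨hd.1, by linarith [hd.2]⟩
  -- the anchor
  set sα := ‖D.boundary α - D.boundary (c zA)‖ with hsα
  obtain ⟨-, -, hsαℓ⟩ := tp_inside_dist D.toJordanDomain hcmono hdir hmono zA hαA
  change ‖D.boundary (c (zA + 1)) - D.boundary α‖ = ‖D.boundary (c (zA + 1)) - D.boundary (c zA)‖ - sα
    at hsαℓ
  have hdAc' := hdAc
  rw [hsαℓ] at hdAc'
  have hA0 : (D.boundary (c zA) * (-Complex.I) ^ (a zA)).re = (D.boundary (c zA)).re := by
    rw [hzA0, pow_zero, mul_one]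
  have hαre : (D.boundary α).re = (D.boundary (c zA)).re + sα := by
    have h := hdir zA α ⟨hαA.1.le, hαA.2.le⟩
    rw [hzA0, pow_zero, mul_one] at h
    rw [h, Complex.add_re, Complex.ofReal_re]
  have hslot_s : ∀ i, sα - δ - s₀ ≤ δ * ((an1 + x i : ℤ) : ℝ) - (D.boundary (c zA) * (-Complex.I) ^ (a zA)).re ∧
      δ * ((an1 + x i : ℤ) : ℝ) - (D.boundary (c zA) * (-Complex.I) ^ (a zA)).re ≤ sα + s₀ := by
    intro i
    have hx := abs_le.1 (hxs₀ i)
    rw [hA0]; push_cast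
    constructor <;> linarith [han1.1, han1.2, hαre]
  -- flatness
  have hFp : ∀ i, Fl (p i) ∧ FlR (p i) := by
    intro i
    obtain ⟨h1, h2, -⟩ := hA' (zm i) (xi i) (by linarith [(hinit i).1, (hmi i).1])
      (by linarith [(hinit i).2, (hmi i).2])
    rw [hp_eq i]; exact ⟨h2, h1⟩
  have hFs : ∀ i, Fl ((an1 + x i) • dir (K zA) + Y zA • dir (K zA + 1)) ∧
      FlR ((an1 + x i) • dir (K zA) + Y zA • dir (K zA + 1)) := by
    intro i
    obtain ⟨h1, h2, -⟩ := hA' zA (an1 + x i) (by linarith [(hslot_s i).1, hdAc.1])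
      (by linarith [(hslot_s i).2, hdAc'.2])
    exact ⟨h2, h1⟩
  refine ⟨hFp, hFs, ?_, ?_, ?_⟩
  · -- two initial points
    intro i₁ i₂ hne
    rw [hp_eq i₁, hp_eq i₂, hSep, hK, hK, hY, hY]
    refine (tp_sep_rail_points D.toJordanDomain hcmono ha4 hdir hδ hr.le (zm i₁) (xi i₁) (zm i₂) (xi i₂)
      (by linarith [(hinit i₁).1, (hmi i₁).1]) (by linarith [(hinit i₁).2, (hmi i₁).2])
      (by linarith [(hinit i₂).1, (hmi i₂).1]) (by linarith [(hinit i₂).2, (hmi i₂).2]) ?_).1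
    intro t ht t' ht' hnt hnt'
    have h1 : dist (D.pt i₁) (D.boundary t) ≤ r / 4 := by
      rw [hpt, tp_same_edge_dist D.toJordanDomain hdir (zm i₁) ⟨(hzm i₁).1.le, (hzm i₁).2.le⟩ ht, hnt,
        ← hpt]
      rw [abs_le]; constructor <;> linarith [(hinit i₁).1, (hinit i₁).2]
    have h2 : dist (D.pt i₂) (D.boundary t') ≤ r / 4 := by
      rw [hpt, tp_same_edge_dist D.toJordanDomain hdir (zm i₂) ⟨(hzm i₂).1.le, (hzm i₂).2.le⟩ ht', hnt',
        ← hpt]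
      rw [abs_le]; constructor <;> linarith [(hinit i₂).1, (hinit i₂).2]
    have h3 := hdmm i₁ i₂ hne
    have h4 := dist_triangle (D.pt i₁) (D.boundary t) (D.pt i₂)
    have h5 := dist_triangle (D.boundary t) (D.boundary t') (D.pt i₂)
    rw [dist_comm] at h2
    linarith
  · -- two slots
    intro i₁ i₂ hne
    rw [hSep]
    have hxne : x i₁ ≠ x i₂ := by
      intro h
      have := hxsep i₁ i₂ hne
      rw [h, sub_self] at this
      push_cast at this
      have h0 : 0 < r / δ := by positivity
      nlinarith
    exact tp_sep_same_rail hδ hr.le (K zA) (Y zA) (an1 + x i₁) (an1 + x i₂)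
      (tp_slots_apart hδ hr.le hxne (hxsep i₁ i₂ hne) an1)
  · -- an initial point and a slot
    intro i₁ i₂
    rw [hp_eq i₁, hSep, hSep, hK, hK, hY, hY]
    refine tp_sep_rail_points D.toJordanDomain hcmono ha4 hdir hδ hr.le (zm i₁) (xi i₁) zA (an1 + x i₂)
      (by linarith [(hinit i₁).1, (hmi i₁).1]) (by linarith [(hinit i₁).2, (hmi i₁).2])
      (by linarith [(hslot_s i₂).1, hdAc.1]) (by linarith [(hslot_s i₂).2, hdAc'.2]) ?_
    intro t ht tw htw hnt hntw
    have h1 : dist (D.pt i₁) (D.boundary t) ≤ r / 4 := by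
      rw [hpt, tp_same_edge_dist D.toJordanDomain hdir (zm i₁) ⟨(hzm i₁).1.le, (hzm i₁).2.le⟩ ht, hnt,
        ← hpt]
      rw [abs_le]; constructor <;> linarith [(hinit i₁).1, (hinit i₁).2]
    have h2 : dist (D.boundary α) (D.boundary tw) ≤ δ + s₀ := by
      rw [tp_same_edge_dist D.toJordanDomain hdir zA ⟨hαA.1.le, hαA.2.le⟩ htw, hntw]
      change |sα - (δ * ((an1 + x i₂ : ℤ) : ℝ) - (D.boundary (c zA) * (-Complex.I) ^ (a zA)).re)| ≤ δ + s₀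
      rw [abs_le]; constructor <;> linarith [(hslot_s i₂).1, (hslot_s i₂).2]
    have h3 := hdA i₁
    have h4 := dist_triangle (D.boundary α) (D.boundary tw) (D.pt i₁)
    have h5 := dist_triangle (D.boundary tw) (D.boundary t) (D.pt i₁)
    rw [dist_comm] at h1
    rw [dist_comm]
    linarith

end Summit.CriticalPhenomena.CardyFormulaZ2.Cruxes.BoundaryDefectGaussianR.RainbowMonomialsInExcursionKernels

end
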